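import Summits.QuantumFields.YangMills.Theorems.SmallCircleAnchorAnchorGapDopLocality
import Summits.QuantumFields.YangMills.Theorems.SmallCircleAnchorAnchorGapCovLineDop
import HarnessLib

/-!
# Crux `AnchorGap` (stmt-QuantumFields-11141), line `registered` — the NO-BRANCHING Leibniz rule:
# GREP's line operator `Dop ℓ` on a product of ATOM-LOCAL factors is a sum over the coordinate pairs
# of `ℓ` of products with exactly two factors differentiated once each; and the iterated line
# operators are linear (analytic half of GBND, part 1)

GBND (`stub_bbfActivityTreeBound`, helper ✓p786530) consumes a PER-SCRIPT bound
`|E(cov X σ_s(t))(s.lines.foldl Dop (Π_{b∈X} G_b))| ≤ M · Π_{ℓ ∈ lines(s)} y_ℓ`.  The reason such a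
bound holds without a `|X|^{#derivatives}` multinomial loss is the atom-locality of GREP's factors
(`stub_gaussianBBFPolymerRep`: `(∀ i, blk i = b → φ i = ψ i) → G_b φ = G_b ψ`): a line `ℓ = {a, a'}`
acts by `½ Σ_{blk x = a, blk y = a'} C_xy ∂_x∂_y` (both orientations) and `∂_x` only sees the factor of
the atom `blk x` (✓`DopLocal.fderiv_apply_eq_zero_of_seesOnly`, p793007), so each line puts exactly
ONE derivative on each of its two atoms' factors.

* §1 `fderiv_prod_apply_single` — `D(Π_{b∈X} F_b)(φ) e_y = Π_{b∈X} (b = blk y ? DF_b(φ)e_y : F_b(φ))`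
  (`blk y ∈ X`; Mathlib `fderiv_finsetProd`); `iteratedFDeriv_two_prod_single` — the same for
  `∂_x∂_y`, `blk x ≠ blk y` both in `X` (✓`PolyGrowth.fderiv_partial_apply`); `dop_prod_eq_sum` —
  `Dop ℓ (Π_b F_b) = Σ_{x,y} (½·𝟙[{blk x,blk y} = ℓ, blk x ≠ blk y]·C_xy) · Π_b F^{(x,y)}_b` with
  `F^{(x,y)}_b = (b = blk x ? ∂_x F_b : b = blk y ? ∂_y F_b : F_b)`;
* §2 `foldl_dop_lincomb` — `L.foldl Dop (Σ_k c_k H_k) = Σ_k c_k · L.foldl Dop H_k` for smooth `H_k`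
  (`iteratedFDeriv_fun_sum_apply`, `iteratedFDeriv_const_smul_apply'`; smoothness of each `Dop ℓ H` by
  ✓`LineDop.dop_contDiff`, p792516).

Part 2 (`SmallCircleAnchorAnchorGapActivityBound.lean`): the bound itself, by induction on the lines.
[folklore] (Battle–Brydges–Federbush ∕ Glimm–Jaffe–Spencer tree bounds); no definition, no named
fact; GREP's `Dop`-step text INLINED token for token.
-/

set_option autoImplicit false

namespace Summit.QuantumFields.YangMills.Theorems.AnchorGap.ActBound

open Finset
open scoped ContDiff

variable {ι : Type} [Fintype ι] [DecidableEq ι] {β : Type} [DecidableEq β]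

/-! ### §1 The no-branching Leibniz rule for atom-local factors -/

/-- **No-branching product rule.** For atom-local differentiable factors and a coordinate `y` whose
atom lies in `X`: `D(Π_{b∈X} F_b)(φ) e_y = Π_{b∈X} (b = blk y ? DF_b(φ) e_y : F_b(φ))`. [folklore] -/
theorem fderiv_prod_apply_single (blk : ι → β) (X : Finset β) {F : β → (ι → ℝ) → ℝ}
    (hF : ∀ b, Differentiable ℝ (F b))
    (hFl : ∀ (b : β) (φ ψ : ι → ℝ), (∀ i : ι, blk i = b → φ i = ψ i) → F b φ = F b ψ)
    (y : ι) (hy : blk y ∈ X) (φ : ι → ℝ) :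
    fderiv ℝ (fun φ : ι → ℝ => ∏ b ∈ X, F b φ) φ (Pi.single y 1)
      = ∏ b ∈ X, (if b = blk y then fderiv ℝ (F b) φ (Pi.single y 1) else F b φ) := by
  classical
  rw [fderiv_finsetProd (fun b _ => (hF b) φ)]
  have hzero : ∀ b ∈ X, b ≠ blk y → fderiv ℝ (F b) φ (Pi.single y 1) = 0 := by
    intro b _ hb
    exact DopLocal.fderiv_apply_eq_zero_of_seesOnly (fun i => blk i = b) (hF b) (hFl b) φ _
      (fun i hi => Pi.single_eq_of_ne (show i ≠ y from fun h => hb (by rw [← hi, h])) _)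
  rw [_root_.sum_apply, Finset.sum_eq_single (blk y)]
  · rw [_root_.smul_apply, smul_eq_mul, ← Finset.mul_prod_erase X _ hy, if_pos rfl,
      mul_comm]
    congr 1
    exact Finset.prod_congr rfl fun b hb => by rw [if_neg (Finset.ne_of_mem_erase hb)]
  · intro b hb hne
    rw [_root_.smul_apply, hzero b hb hne, smul_zero]
  · intro h; exact absurd hy h

omit [DecidableEq ι] in
/-- The family with one factor differentiated is again atom-local. [folklore] -/
theorem local_update_fderiv (blk : ι → β) {F : β → (ι → ℝ) → ℝ} (hF : ∀ b, Differentiable ℝ (F b))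
    (hFl : ∀ (b : β) (φ ψ : ι → ℝ), (∀ i : ι, blk i = b → φ i = ψ i) → F b φ = F b ψ)
    (a : β) (v : ι → ℝ) :
    ∀ (b : β) (φ ψ : ι → ℝ), (∀ i : ι, blk i = b → φ i = ψ i) →
      (if b = a then fderiv ℝ (F b) φ v else F b φ) = (if b = a then fderiv ℝ (F b) ψ v else F b ψ) := by
  intro b φ ψ h
  by_cases hb : b = a
  · rw [if_pos hb, if_pos hb]
    exact DopLocal.seesOnly_fderiv_apply (fun i => blk i = b) (hF b) (hFl b) v φ ψ h
  · rw [if_neg hb, if_neg hb]; exact hFl b φ ψ h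

/-- **No-branching rule for a second partial.** For `blk x ≠ blk y` both in `X`:
`D²(Π_{b∈X} F_b)(φ)[e_x, e_y] = Π_{b∈X} F^{(x,y)}_b(φ)` with
`F^{(x,y)}_b = (b = blk x ? ∂_x F_b : b = blk y ? ∂_y F_b : F_b)`. [folklore] -/
theorem iteratedFDeriv_two_prod_single (blk : ι → β) (X : Finset β) {F : β → (ι → ℝ) → ℝ}
    (hF : ∀ b, ContDiff ℝ (⊤ : ℕ∞) (F b))
    (hFl : ∀ (b : β) (φ ψ : ι → ℝ), (∀ i : ι, blk i = b → φ i = ψ i) → F b φ = F b ψ)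
    (x y : ι) (hx : blk x ∈ X) (hy : blk y ∈ X) (hxy : blk x ≠ blk y) (φ : ι → ℝ) :
    iteratedFDeriv ℝ 2 (fun φ : ι → ℝ => ∏ b ∈ X, F b φ) φ ![Pi.single x 1, Pi.single y 1]
      = ∏ b ∈ X, (if b = blk x then fderiv ℝ (F b) φ (Pi.single x 1)
          else if b = blk y then fderiv ℝ (F b) φ (Pi.single y 1) else F b φ) := by
  classical
  have hFd : ∀ b, Differentiable ℝ (F b) := fun b => (hF b).differentiable (by simp)
  -- the family after `∂_y`
  have h1 : (fun φ : ι → ℝ => fderiv ℝ (fun φ : ι → ℝ => ∏ b ∈ X, F b φ) φ (Pi.single y 1))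
      = fun φ => ∏ b ∈ X, (if b = blk y then fderiv ℝ (F b) φ (Pi.single y 1) else F b φ) :=
    funext fun φ => fderiv_prod_apply_single blk X hFd hFl y hy φ
  have hGc : ∀ b, ContDiff ℝ (⊤ : ℕ∞)
      (fun φ => if b = blk y then fderiv ℝ (F b) φ (Pi.single y 1) else F b φ) := by
    intro b
    by_cases hb : b = blk y
    · simp only [if_pos hb]; exact PolyGrowth.contDiff_partial (hF b) _
    · simp only [if_neg hb]; exact hF b
  have hGd : ∀ b, Differentiable ℝ
      (fun φ => if b = blk y then fderiv ℝ (F b) φ (Pi.single y 1) else F b φ) :=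
    fun b => (hGc b).differentiable (by simp)
  rw [← PolyGrowth.fderiv_partial_apply (contDiff_prod fun b _ => hF b), h1,
    fderiv_prod_apply_single blk X hGd (local_update_fderiv blk hFd hFl (blk y) _) x hx φ]
  refine Finset.prod_congr rfl fun b _ => ?_
  by_cases hbx : b = blk x
  · rw [if_pos hbx, if_pos hbx]
    have hby : b ≠ blk y := fun h => hxy (hbx ▸ h ▸ rfl)
    simp only [if_neg hby]
  · rw [if_neg hbx, if_neg hbx]

/-- **`Dop ℓ` on a product of atom-local factors, as a sum over the coordinate pairs of `ℓ`**, for a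
line between two atoms of `X`. [folklore] -/
theorem dop_prod_eq_sum (blk : ι → β) (C : Matrix ι ι ℝ) (X : Finset β) (ℓ : Sym2 β)
    (hℓ : ∀ a ∈ ℓ, a ∈ X) {F : β → (ι → ℝ) → ℝ} (hF : ∀ b, ContDiff ℝ (⊤ : ℕ∞) (F b))
    (hFl : ∀ (b : β) (φ ψ : ι → ℝ), (∀ i : ι, blk i = b → φ i = ψ i) → F b φ = F b ψ)
    (φ : ι → ℝ) :
    ((1 / 2 : ℝ) * ∑ x : ι, ∑ y : ι, if s(blk x, blk y) = ℓ ∧ blk x ≠ blk y then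
        C x y * iteratedFDeriv ℝ 2 (fun φ : ι → ℝ => ∏ b ∈ X, F b φ) φ
          ![Pi.single x 1, Pi.single y 1] else 0)
      = ∑ x : ι, ∑ y : ι, ((1 / 2 : ℝ) * if s(blk x, blk y) = ℓ ∧ blk x ≠ blk y then C x y else 0)
        * ∏ b ∈ X, (if b = blk x then fderiv ℝ (F b) φ (Pi.single x 1)
            else if b = blk y then fderiv ℝ (F b) φ (Pi.single y 1) else F b φ) := by
  classical
  rw [Finset.mul_sum]
  refine Finset.sum_congr rfl fun x _ => ?_
  rw [Finset.mul_sum]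
  refine Finset.sum_congr rfl fun y _ => ?_
  by_cases hc : s(blk x, blk y) = ℓ ∧ blk x ≠ blk y
  · rw [if_pos hc, if_pos hc, iteratedFDeriv_two_prod_single blk X hF hFl x y
      (hℓ _ (hc.1 ▸ Sym2.mem_mk_left _ _)) (hℓ _ (hc.1 ▸ Sym2.mem_mk_right _ _)) hc.2 φ]
    ring
  · rw [if_neg hc, if_neg hc]; ring

/-! ### §2 The iterated line operators are linear over finite sums -/

/-- **Linearity of the iterated line operators** over finite sums of smooth functions
(`iteratedFDeriv_fun_sum_apply`, `iteratedFDeriv_const_smul_apply`). [folklore] -/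
theorem foldl_dop_lincomb (blk : ι → β) (C : Matrix ι ι ℝ)
    {κ : Type} (K : Finset κ) :
    ∀ (L : List (Sym2 β)) (c : κ → ℝ) (H : κ → (ι → ℝ) → ℝ), (∀ k, ContDiff ℝ (⊤ : ℕ∞) (H k)) →
      L.foldl (fun (H : (ι → ℝ) → ℝ) (ℓ : Sym2 β) => fun φ : ι → ℝ =>
          (1 / 2 : ℝ) * ∑ x : ι, ∑ y : ι, if s(blk x, blk y) = ℓ ∧ blk x ≠ blk y then
            C x y * iteratedFDeriv ℝ 2 H φ ![Pi.single x 1, Pi.single y 1] else 0)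
        (fun φ => ∑ k ∈ K, c k * H k φ)
      = fun φ => ∑ k ∈ K, c k * L.foldl (fun (H : (ι → ℝ) → ℝ) (ℓ : Sym2 β) => fun φ : ι → ℝ =>
          (1 / 2 : ℝ) * ∑ x : ι, ∑ y : ι, if s(blk x, blk y) = ℓ ∧ blk x ≠ blk y then
            C x y * iteratedFDeriv ℝ 2 H φ ![Pi.single x 1, Pi.single y 1] else 0) (H k) φ := by
  classical
  intro L
  induction L with
  | nil => intro c H _; rfl
  | cons ℓ L ih =>
    intro c H hH
    simp only [List.foldl_cons]
    -- one step: `Dop ℓ (Σ c_k H_k) = Σ c_k Dop ℓ H_k`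
    have hstep : (fun φ : ι → ℝ => (1 / 2 : ℝ) * ∑ x : ι, ∑ y : ι,
        if s(blk x, blk y) = ℓ ∧ blk x ≠ blk y then
          C x y * iteratedFDeriv ℝ 2 (fun φ => ∑ k ∈ K, c k * H k φ) φ
            ![Pi.single x 1, Pi.single y 1] else 0)
        = fun φ => ∑ k ∈ K, c k * ((1 / 2 : ℝ) * ∑ x : ι, ∑ y : ι,
          if s(blk x, blk y) = ℓ ∧ blk x ≠ blk y then
            C x y * iteratedFDeriv ℝ 2 (H k) φ ![Pi.single x 1, Pi.single y 1] else 0) := by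
      funext φ
      have h2 : ∀ m : Fin 2 → ι → ℝ, iteratedFDeriv ℝ 2 (fun φ => ∑ k ∈ K, c k * H k φ) φ m
          = ∑ k ∈ K, c k * iteratedFDeriv ℝ 2 (H k) φ m := by
        intro m
        rw [iteratedFDeriv_fun_sum_apply fun k _ =>
          ((contDiff_const.mul (hH k)).of_le (ENat.natCast_le_of_coe_top_le_withTop le_rfl 2)).contDiffAt]
        rw [_root_.sum_apply]
        refine Finset.sum_congr rfl fun k _ => ?_
        have : (fun φ => c k * H k φ) = fun φ => c k • H k φ := rfl
        rw [this, iteratedFDeriv_const_smul_apply'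
          ((hH k).contDiffAt.of_le (ENat.natCast_le_of_coe_top_le_withTop le_rfl 2)), _root_.smul_apply,
          smul_eq_mul]
      simp_rw [h2]
      -- rearrange the finite sums
      calc (1 / 2 : ℝ) * ∑ x : ι, ∑ y : ι, (if s(blk x, blk y) = ℓ ∧ blk x ≠ blk y then
              C x y * ∑ k ∈ K, c k * iteratedFDeriv ℝ 2 (H k) φ ![Pi.single x 1, Pi.single y 1]
              else 0)
          = (1 / 2 : ℝ) * ∑ x : ι, ∑ y : ι, ∑ k ∈ K, c k * (if s(blk x, blk y) = ℓ ∧ blk x ≠ blk y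
              then C x y * iteratedFDeriv ℝ 2 (H k) φ ![Pi.single x 1, Pi.single y 1] else 0) := by
            congr 1
            refine Finset.sum_congr rfl fun x _ => Finset.sum_congr rfl fun y _ => ?_
            split_ifs
            · rw [Finset.mul_sum]
              exact Finset.sum_congr rfl fun k _ => by ring
            · simp
        _ = (1 / 2 : ℝ) * ∑ k ∈ K, ∑ x : ι, ∑ y : ι, c k * (if s(blk x, blk y) = ℓ ∧ blk x ≠ blk y
              then C x y * iteratedFDeriv ℝ 2 (H k) φ ![Pi.single x 1, Pi.single y 1] else 0) := by
            congr 1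
            calc ∑ x : ι, ∑ y : ι, ∑ k ∈ K, c k * (if s(blk x, blk y) = ℓ ∧ blk x ≠ blk y
                    then C x y * iteratedFDeriv ℝ 2 (H k) φ ![Pi.single x 1, Pi.single y 1] else 0)
                = ∑ x : ι, ∑ k ∈ K, ∑ y : ι, c k * (if s(blk x, blk y) = ℓ ∧ blk x ≠ blk y
                    then C x y * iteratedFDeriv ℝ 2 (H k) φ ![Pi.single x 1, Pi.single y 1] else 0) :=
                  Finset.sum_congr rfl fun x _ => Finset.sum_comm
              _ = _ := Finset.sum_comm
        _ = ∑ k ∈ K, c k * ((1 / 2 : ℝ) * ∑ x : ι, ∑ y : ι,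
              if s(blk x, blk y) = ℓ ∧ blk x ≠ blk y then
                C x y * iteratedFDeriv ℝ 2 (H k) φ ![Pi.single x 1, Pi.single y 1] else 0) := by
            rw [Finset.mul_sum]
            refine Finset.sum_congr rfl fun k _ => ?_
            have hT : (∑ x : ι, ∑ y : ι, c k * (if s(blk x, blk y) = ℓ ∧ blk x ≠ blk y
                then C x y * iteratedFDeriv ℝ 2 (H k) φ ![Pi.single x 1, Pi.single y 1] else 0))
                = c k * ∑ x : ι, ∑ y : ι, (if s(blk x, blk y) = ℓ ∧ blk x ≠ blk y
                  then C x y * iteratedFDeriv ℝ 2 (H k) φ ![Pi.single x 1, Pi.single y 1] else 0) := by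
              rw [Finset.mul_sum]
              exact Finset.sum_congr rfl fun x _ => by rw [Finset.mul_sum]
            rw [hT]
            ring
    rw [hstep]
    exact ih c _ fun k => LineDop.dop_contDiff blk C ℓ (hH k)

end Summit.QuantumFields.YangMills.Theorems.AnchorGap.ActBound
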